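import Mathlib
import Summits.RiemannHypothesis.RiemannHypothesis.Theorems.JensenPolynomialsDefs
import Literature.NumberTheory.LFunctions.JensenXiExponentialRange

/-!
# Rung J-P (P1⁰) leaf closer — `ExplicitGORTTWPow10` holds (RH-FREE)

**RH-FREE proof-of-data (ladder RH, column JENSEN, rung J-P).** The registered rung leaf
`Summit.RiemannHypothesis.RiemannHypothesis.Theorems.JensenPolynomials.ExplicitGORTTWPow10`
(`∀ d n, 1 ≤ d → 10^(2d+5) ≤ n → (jensenPoly xiTaylorCoeff d n).Splits`, file
`Theorems/JensenPolynomialsDefs.lean` §1) is *literally* the statement of the kernel theorem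
`Literature.NumberTheory.LFunctions.explicitGORTTW_pow_ten`
(`Literature/NumberTheory/LFunctions/JensenXiExponentialRange.lean`, p409281; zero-free, height-free
mechanism: Laguerre skeleton → Szegő/Sonin envelopes → mode matching → two-piece variance floor →
`d + 1` sign changes). This file records the one-line closer `explicitGORTTWPow10_holds`, and the
corollary P0 `explicitGORTTW1100_holds` (`n ≥ 1100^(d+1)`: for `d ≥ 2`, `10^(2d+5) ≤ 1100^(d+1)`;
for `d = 1` the Jensen polynomial is linear).

WHAT THIS IS NOT: nothing here bears on the zeros of `ζ`; by the tree's barrier entries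
`Literature.Barriers.RiemannHypothesis.JensenPolynomials*` (Farmer 2022) no large-shift hyperbolicity
statement carries information about RH. Import closure: `JensenXiExponentialRange` (zero-free) and the
Defs file only — no `riemannHypothesisUpTo`, no RH-to-height input.
-/

-- D-0017: `Summit.RiemannHypothesis.RiemannHypothesis.…` duplicates the namespace BY DESIGN (single-problem summit).
set_option linter.dupNamespace false

namespace Summit.RiemannHypothesis.RiemannHypothesis.Theorems.JensenPolynomials

open Literature.NumberTheory.LFunctions Polynomial

/-- **Rung leaf J-P (P1⁰), RH-FREE, PROVED:** for every `d ≥ 1` and every `n ≥ 10^(2d+5)` the Jensen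
polynomial `J^{d,n}_γ` of `γ = xiTaylorCoeff` is hyperbolic — the registered leaf `ExplicitGORTTWPow10`,
closed by the Literature theorem `explicitGORTTW_pow_ten` (same statement, verbatim). -/
theorem explicitGORTTWPow10_holds : ExplicitGORTTWPow10 :=
  explicitGORTTW_pow_ten

/-- **P0, RH-FREE, PROVED:** explicit GORTTW for `ξ` with base `1100` — for every `d ≥ 1` and every
`n ≥ 1100^(d+1)`, `J^{d,n}_γ` is hyperbolic. From P0′: for `d ≥ 2`, `10^(2d+5) ≤ 1100^(d+1)`
(`10^(2d+5) = 100^d·10^5` and `1100^(d+1) = 100^d·11^d·1100` with `11^d·1100 ≥ 121·1100 ≥ 10^5`);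
for `d = 1`, `J^{1,n}_γ` has degree `≤ 1` and splits trivially (zero-free). -/
theorem explicitGORTTW1100_holds : ExplicitGORTTW1100 := by
  intro d n hd hn
  by_cases hd1 : d ≤ 1
  · have hdeg : (jensenPoly xiTaylorCoeff d n).natDegree ≤ 1 :=
      (Literature.Analysis.Complex.PolyaSchur.natDegree_jensenPoly_le xiTaylorCoeff d n).trans hd1
    exact Splits.of_natDegree_le_one hdeg
  · refine explicitGORTTWPow10_holds d n hd (le_trans ?_ hn)
    have h121 : 11 ^ 2 ≤ 11 ^ d := Nat.pow_le_pow_right (by norm_num) (by omega)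
    have h' : 100000 ≤ 11 ^ d * 1100 := by
      have : 121 ≤ 11 ^ d := by simpa using h121
      omega
    have e1 : (10 : ℕ) ^ (2 * d + 5) = 100 ^ d * 100000 := by
      rw [pow_add, pow_mul]; norm_num
    have e2 : (1100 : ℕ) ^ (d + 1) = 100 ^ d * (11 ^ d * 1100) := by
      rw [show (1100 : ℕ) = 100 * 11 by norm_num, mul_pow]; ring
    rw [e1, e2]
    exact Nat.mul_le_mul_left _ h'

end Summit.RiemannHypothesis.RiemannHypothesis.Theorems.JensenPolynomials
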